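import Literature.MathematicalPhysics.QuantumFieldTheory.Balaban1983to89.B6LapLegKLevelV1
import Literature.MathematicalPhysics.QuantumFieldTheory.Balaban1983to89.B6Partition118KLevelFineMixed

/-!
# `Balaban1983to89.B6RandomWalkL2Grad2CubeV1` — T. Bałaban, *Propagators and renormalization transformations for lattice gauge theories. II*,
# Commun. Math. Phys. **96** (1984) 223–250 [Balaban1984PropagatorsII], (2.141) p. 247, THE FIRST LEG OF THE WALK FOR THE ENTRY `‖ζ∇∇GJ‖` OF (2.140),
# PART 1 (CUBE ALGEBRA): the operator identity for `∇_ν∇_μ(h_□G_□h_□)` on the k-level torus, the supports, depths and sizes of its cut-off factors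
# `S_νS_μh_□`, `∇_ν(S_μh_□)`, `S_ν(∇_μh_□)`, `∇_ν∇_μh_□` (file 8 of the block-`ℓ²` bricks of `…B6RandomWalkL2`)

statement-level skeleton of published theorems with citation tags; proofs where landed; nothing here is a claim about the Yang–Mills mass gap

WHAT IS PRINTED (p. 247 [PDF 25]): (2.140) *"‖ζGJ‖, ‖ζ∇GJ‖, ‖ζG∇*J‖, ‖ζ∇G∇*J‖, ‖ζ∇∇GJ‖, ‖ζG∇*∇*J‖ ≤ O(1)[(Lʲη)², Lʲη, Lʲη, 1, 1, 1]e^{−δ₃d(y,y′)}|ζ|‖J‖"*;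
(2.141) *"G = G₀(I − R)⁻¹ = Σ_ω h_{□₀}G_{□₀}h_{□₀}·K_{□₁,□₂}G_{□₂}h_{□₂}·… and the series above is convergent in the norms appearing in the inequalities
(2.136)–(2.140)"*; p. 239 [PDF 17] (2.92) line 1 (the commutator of the derivatives with `h_□`); p. 247 after (2.134): *"|∇h_□′| ≤ O(1)(MLʲη)⁻¹"*.

CITATION HEADER (lean-in-tree rule) — WHAT IS REPRODUCED.  Phase-2 file of the `lit-balaban` typed skeleton (HOME `run/shared/lean/pub/lit-balaban/`), seat
**p22 gen 29** (free-target protocol G.5-34(d), TAKING HOME/STATUS 2026-08-24T13:26Z, cc r03/p38); SKELETON rows **B6.Prop2.6** × B6.Eq2.141 × B6.Eq2.92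
(cells only; decls of record untouched).  The sibling of p38's `…B6GradLegKLevelV1` (one forward difference, gen 30) and `…B6LapLegKLevelV1` (the Laplacian,
gen 31) for TWO FORWARD DIFFERENCES `∇_ν∇_μ` — the shape of the census slot (2.140)₅ (`DV ν c′ ∘ DV μ c′ ∘ G`).  On r03's cube members (`…B6CubeWindowV1.Gl`,
the skeleton's `h_□ = hB`, p38's legs `E_e = EC` of `…B6Eq292MemberTorusV1`), p38's differences `DV`, `shB` BY NAME:
* §1 THE BLOCKS TWO LATTICE STEPS AROUND `supp h_□` LIE IN `□⁺` (`M_h ≥ 8`): `dist_le_two_of_torus`, **`blkOf_mem_QT_of_near2_hT`** (p38's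
  `…B6CubeCoeffSizesV1.blkOf_mem_QT_of_near_hT` with torus distance `≤ 2`: the second forward difference `∇_ν∇_νh_□(x)` reads `h_□(x + 2e_ν)`),
  `blkV1_mem_ST_of_hB_shift_shift_ne_zero`;
* §2 THE SIZES `|∇_ν(S_μh_□)|, |S_ν(∇_μh_□)| ≤ |c′|·C1F/(8S/5)` (`abs_DV_shB_hB_le`, `abs_shB_DV_hB_le`), `|∇_ν∇_μh_□| ≤ c′²·C₂ˣ/(8S/5)²` (`abs_DV_DV_hB_le`, from p22 gen 26's unified second-difference step `…B6Partition118KLevelFineMixed.abs_hT_diff_step_le`,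
  pure and mixed) and the supports / window depths of the four cut-off factors (`shB_shB_hB_deep`, `DV_shB_hB_deep`, `shB_DV_hB_deep`, the `_support` lemmas);
* §3 THE OPERATOR IDENTITIES: **`EC_mul_EC_mul_Gl_eq`** (`E_(ν,+)E_(μ,+)G_□ = τ_{−v}(s(□)⁻¹•ε(∇_ν∇_μG_□)ρ)τ_v` through the bijective window, as r03's
  `EC_mul_Gl_eq`) and **`DV_DV_sandwich_eq`**:
  `∇_ν∇_μ(h_□G_□h_□) = (c′/L^{j₀})²•(S_νS_μh_□)·(E_(ν,+)E_(μ,+)G_□)·h_□ + (c′/L^{j₀})•[(∇_ν(S_μh_□))·(E_(μ,+)G_□)·h_□ + (S_ν(∇_μh_□))·(E_(ν,+)G_□)·h_□]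
  + (∇_ν∇_μh_□)·G_□·h_□` (p38's `DV_sandwich_eq` and the product rule `DV_mul_mulOp` once more).
THEOREMS ONLY (no definition, no `def … : Prop`, no new hypothesis); IMPORTS BY NAME, restating nothing; standard axioms.  The block-`ℓ²` legs of the
four terms and the first `ℓ²` leg of (2.141) for `∇∇G` per cube are the sibling `…B6RandomWalkL2Grad2LegV1`.

HONEST SCOPE / DIVERGENCES.  (1) Lattice units of the k-level V1 torus, `c′ ≠ 0` the fine factor; hypotheses as p38's leg files (`M_h = Lᵃ ≥ 8`, `R ≥ 2L²`,
`P′ ≥ 5`, placed cube).  (2) Bookkeeping over landed estimates (r03's window/cube files, p38's legs, p22's partition sizes); the constant `C₂ˣ = C₂ + C₂ᴹ`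
is ours (print: *"O(1)"*).  (3) Toward the unowned census slot (2.140)₅ (and ₆ by transposition); NOT that slot.  NOT summit progress.
Unit `lit-balaban-p22` (gen 29), 2026-08-24.
-/

noncomputable section

open scoped BigOperators
open Finset

namespace Literature.MathematicalPhysics.QuantumFieldTheory.Balaban1983to89.B6RandomWalkL2Grad2CubeV1

open LatticeFieldCalculus
open B4ContourShift (supNorm)
open B4Reflection242 (boxDom)
open B4TorusKernel.MultiPeriod (torusSupNorm)
open B6MultiLevelBoxOperator (N0 bigSide)
open B6MultiLevelTorusOperator (TDomains tshift tshift_tshift unitVec one_le_of_mem torusSupNorm_tshift_sub)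
open B6Cover236MultiLevelBlocks (cubes side ctr Q mem_Q)
open B6Geom246MultiLevelBox (bset blkOf toR dist_toR_cen_le cen supNorm_eq_dist)
open B6Geom246MultiLevelTorus (geomT torusSupNorm_neg)
open B6Eq238MultiLevelTorus (svec)
open B6Cov2110WeightV1 (torusSupNorm_sub_le)
open B6TorusDepthDistance (SiteDeep min_le_torusSupNorm_sub blkOf_eq_blkMap_symm)
open B6Partition118KLevelFine (hF dist_lt_of_hF_ne_zero lev_window_of_dist_lt_three_halves)
open B6Partition118KLevelTorus (hT)
open B6Partition118KLevelTorusCentral (Dch σch cc QT side_cc hT_eq_hF_cc)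
open B6Partition118KLevelTorusBinders (torusSupNorm_σch_symm siteDeep_three_of_hF_ne_zero)
open B6Partition118KLevelFineSizes (C1F C1F_nonneg)
open B6Partition118KLevelFineMixed (C2X C2X_bounds abs_hT_diff_step_le)
open B6CubeCoeffSizesV1 (torusSupNorm_tshift_unitVec_le one_le_ell)
open B6Prop26Gluing (mulOp mulOp_apply)
open B6Ineq2133TwoScaleV1 (onFun)
open B6Prop26ReachTransplant (transplant transplant_mul_of_bij)
open B6GlobalChartV1 (PV toBox blkV1 domT)
open B6AgreeLapV1Chart (cB eB DeepS deepS_mono unshift_mem_deepS onFun_comp)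
open B6SectAOperatorsV1 (BondIdx)
open B6TranslateV1 (trV trV_apply)
open B6TranslateTorusV1 (vch TB)
open B6ScalarChartV1 (toBox_shift)
open B6Prop26KLevelSkeletonV1 (hB hB_apply ST mem_ST blkV1_mem_QT_of_hB_ne_zero)
open B6CubeWindowV1 (tC x0 hx0 hfit wC hch_deep Placed j0 Gl trV_hB sc)
open B6Eq292MemberTorusV1 (EC)
open B6CubeInDecayV1 (conj_mul Gl_eq)
open B6GradLegKLevelV1 (shB shB_apply DV DV_apply DV_mul_mulOp trV_shB EC_true mulOp_mul_EC_true blkV1_mem_ST_of_hB_shift_ne_zero shB_hB_deep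
  DV_sandwich_eq)
open B6LapLegKLevelV1 (hB_deep DV_hB_deep)
open B10StarCount (unshift_shift)

variable {d ℓ : ℕ}

/-! ## §1  The blocks two lattice steps around `supp h_□` lie in `□⁺` -/

section Near

variable {Mh k R : ℕ} {P : Fin (d + 1) → ℕ}

/-- two sites at torus distance `≤ 2`, one of them `3`-deep, are at lattice distance `≤ 2` (p38's `dist_le_one_of_torus`, one step further).
[cite: Balaban1984PropagatorsII, (2.46) p.231, dictionary (torus vs box)] -/
theorem dist_le_two_of_torus {u v : ↥(boxDom (N0 ℓ Mh k P))} (hu : SiteDeep (N0 ℓ Mh k P) 3 u.1)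
    (huv : torusSupNorm (N0 ℓ Mh k P) (u.1 - v.1) ≤ 2) : dist (toR u.1) (toR v.1) ≤ 2 := by
  have key := min_le_torusSupNorm_sub (by norm_num) hu v.2
  rw [← supNorm_eq_dist]
  rcases min_choice (supNorm (u.1 - v.1)) ((3 : ℤ) : ℝ) with hm | hm
  · rw [hm] at key; exact key.trans huv
  · rw [hm] at key; push_cast at key; linarith

variable {D : TDomains d ℓ Mh k P R}

/-- **THE BLOCKS WITHIN TWO LATTICE STEPS OF `supp h^T_□` LIE IN `□⁺`** (`M_h ≥ 8`): `h^T_□(z′) ≠ 0`, `|z − z′|_T ≤ 2 ⟹ y(z) ∈ QT □` — p38's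
`blkOf_mem_QT_of_near_hT` with one more step (the second forward difference `∇_ν∇_νh_□(x)` reads `h_□` at `x + 2e_ν`; block side `≤ Lʲ⁺¹ ≤ S/8`).
[cite: Balaban1984PropagatorsII, p.239/p.247 (supports of h_□ — our reading), p.235, bookkeeping] -/
theorem blkOf_mem_QT_of_near2_hT (hℓ : 1 ≤ ℓ) (hM8 : 8 ≤ Mh) (hR : 2 * (ℓ + 1) ≤ R) (hP5 : ∀ μ, 5 ≤ P μ) {hMh1 : 1 ≤ Mh} (hP4 : ∀ μ, 4 ≤ P μ)
    (c : ↥(cubes D.toDomains)) {z z' : ↥(boxDom (N0 ℓ Mh k P))} (h : hT D c z' ≠ 0) (hzz' : torusSupNorm (N0 ℓ Mh k P) (z.1 - z'.1) ≤ 2) :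
    blkOf D.toDomains z ∈ QT D hMh1 hP4 c := by
  have hMh : 2 ≤ Mh := le_trans (by norm_num) hM8
  rw [hT_eq_hF_cc hMh1 hP4 c z'] at h
  have hT1 : torusSupNorm (N0 ℓ Mh k P) (((σch D c).symm z').1 - ((σch D c).symm z).1) ≤ 2 := by
    rw [torusSupNorm_σch_symm, show z'.1 - z.1 = -(z.1 - z'.1) by abel, torusSupNorm_neg (one_le_of_mem z.2)]; exact hzz'
  have hnear := dist_le_two_of_torus (siteDeep_three_of_hF_ne_zero hℓ hMh hR hP5 c h) hT1
  have hx'c := dist_lt_of_hF_ne_zero (Dch D c) hMh1 h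
  set x := (σch D c).symm z with hx
  set x' := (σch D c).symm z' with hx'
  have hnear' : dist (toR x.1) (toR x'.1) ≤ 2 := by rw [dist_comm]; exact hnear
  have hp1 : (1 : ℝ) ≤ (((ℓ + 1) ^ (c.1.1 + 1) : ℕ) : ℝ) := by exact_mod_cast Nat.one_le_pow _ _ (by omega)
  have hS : side (Dch D c) (cc D hMh1 hP4 c) = (bigSide ℓ Mh c.1.1 : ℝ) := side_cc hMh1 hP4 c
  have h8 : 8 * (((ℓ + 1) ^ (c.1.1 + 1) : ℕ) : ℝ) ≤ side (Dch D c) (cc D hMh1 hP4 c) := by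
    rw [hS]; unfold bigSide; push_cast
    have : (8 : ℝ) ≤ Mh := by exact_mod_cast hM8
    have hp : (0 : ℝ) ≤ ((ℓ : ℝ) + 1) ^ (c.1.1 + 1) := by positivity
    nlinarith
  have h32 : dist (toR x.1) (ctr (Dch D c) (cc D hMh1 hP4 c)) < 3 / 2 * side (Dch D c) (cc D hMh1 hP4 c) := by
    linarith [dist_triangle (toR x.1) (toR x'.1) (ctr (Dch D c) (cc D hMh1 hP4 c))]
  have hlev := (lev_window_of_dist_lt_three_halves (Dch D c) hMh1 hR h32).2
  have hcen := dist_toR_cen_le (Dch D c) (rfl : blkOf (Dch D c) x = blkOf (Dch D c) x)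
  have hL1 : 1 ≤ ℓ + 1 := by omega
  have hpow : (((ℓ + 1) ^ (blkOf (Dch D c) x).1.1 : ℕ) : ℝ) ≤ (((ℓ + 1) ^ (c.1.1 + 1) : ℕ) : ℝ) := by
    exact_mod_cast Nat.pow_le_pow_right hL1 hlev
  have hQ : blkOf (Dch D c) x ∈ Q (Dch D c) (cc D hMh1 hP4 c) := by
    refine (mem_Q (Dch D c)).2 ?_
    calc dist (cen (Dch D c) (blkOf (Dch D c) x)) (ctr (Dch D c) (cc D hMh1 hP4 c))
        ≤ dist (toR x.1) (cen (Dch D c) (blkOf (Dch D c) x)) + dist (toR x.1) (ctr (Dch D c) (cc D hMh1 hP4 c)) :=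
          dist_triangle_left _ _ _
      _ ≤ dist (toR x.1) (cen (Dch D c) (blkOf (Dch D c) x)) + (dist (toR x.1) (toR x'.1) +
            dist (toR x'.1) (ctr (Dch D c) (cc D hMh1 hP4 c))) := by linarith [dist_triangle (toR x.1) (toR x'.1) (ctr (Dch D c) (cc D hMh1 hP4 c))]
      _ ≤ 5 / 4 * side (Dch D c) (cc D hMh1 hP4 c) := by nlinarith
  unfold QT
  rw [blkOf_eq_blkMap_symm (D := D) hMh1 (fun μ => le_trans (by norm_num) (hP4 μ)) (svec ℓ k c.1.1 c.1.2) z]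
  exact Finset.mem_image_of_mem _ hQ

end Near

/-! ## §2  On the V1 torus: the four cut-off factors of `∇_ν∇_μ(h_□G_□h_□)` — supports, window depths, the size of `∇_ν∇_μh_□` -/

section Cube

variable {hd : 1 ≤ d + 1} {hL : Odd (ℓ + 1) ∧ 1 < ℓ + 1} {a₀ a₁ : ℝ} {m K : ℕ} {Mh k R : ℕ} {P' : Fin (d + 1) → ℕ}
variable (hN : ∀ μ, N0 ℓ Mh k P' μ = (PV d ℓ m K hd hL).sitesPerDir 0) {D : TDomains d ℓ Mh k P' R} (hk : k ≤ m + K)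
  (hMh1 : 1 ≤ Mh) (hP4 : ∀ μ, 4 ≤ P' μ) {a : ℕ} (hMha : Mh = (ℓ + 1) ^ a) (c : ↥(cubes D.toDomains)) (ha : a₀ ≤ a₁)

/-- two unit torus steps move by at most `2`. [cite: Balaban1983RegularityDecay, p.572 (torus), dictionary] -/
theorem torusSupNorm_tshift_tshift_le (ν μ : Fin (d + 1)) (z : ↥(boxDom (N0 ℓ Mh k P'))) :
    torusSupNorm (N0 ℓ Mh k P') (z.1 - (tshift (N0 ℓ Mh k P') (unitVec μ) (tshift (N0 ℓ Mh k P') (unitVec ν) z)).1) ≤ 2 := by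
  have h1 : ∀ i, 1 ≤ N0 ℓ Mh k P' i := one_le_of_mem z.2
  haveI : ∀ i, NeZero (N0 ℓ Mh k P' i) := fun i => ⟨by have := h1 i; omega⟩
  set z₁ := tshift (N0 ℓ Mh k P') (unitVec ν) z with hz₁
  have e1 : torusSupNorm (N0 ℓ Mh k P') (z.1 - z₁.1) ≤ 1 := by
    rw [show z.1 - z₁.1 = -(z₁.1 - z.1) by abel, torusSupNorm_neg h1]; exact torusSupNorm_tshift_unitVec_le h1 ν _
  have e2 : torusSupNorm (N0 ℓ Mh k P') (z₁.1 - (tshift (N0 ℓ Mh k P') (unitVec μ) z₁).1) ≤ 1 := by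
    rw [show z₁.1 - (tshift (N0 ℓ Mh k P') (unitVec μ) z₁).1 = -((tshift (N0 ℓ Mh k P') (unitVec μ) z₁).1 - z₁.1) by abel, torusSupNorm_neg h1]
    exact torusSupNorm_tshift_unitVec_le h1 μ _
  linarith [torusSupNorm_sub_le (N0 ℓ Mh k P') z.1 z₁.1 (tshift (N0 ℓ Mh k P') (unitVec μ) z₁).1]

/-- **THE BLOCK OF `b` IS IN `□⁺` WHEN `h_□(b + e_ν + e_μ) ≠ 0`** (`M_h ≥ 8`, `R ≥ 2L`, `P′ ≥ 5`).
[cite: Balaban1984PropagatorsII, p.239/p.247 (supports of h_□), bookkeeping] -/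
theorem blkV1_mem_ST_of_hB_shift_shift_ne_zero (hM8 : 8 ≤ Mh) (hR : 2 * (ℓ + 1) ≤ R) (hP5 : ∀ μ, 5 ≤ P' μ) (ν μ : Fin (d + 1))
    {b : PBond (PV d ℓ m K hd hL) 0} (h : hB hN D c ⟨(b.src.shift ν).shift μ, b.dir⟩ ≠ 0) : blkV1 hN D b ∈ ST D hMh1 hP4 c := by
  rw [hB_apply] at h
  dsimp only at h
  rw [toBox_shift hN, toBox_shift hN] at h
  exact (mem_ST D hMh1 hP4 c _).2
    (blkOf_mem_QT_of_near2_hT (one_le_ell hL) hM8 hR hP5 hP4 c h (torusSupNorm_tshift_tshift_le ν μ _))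

/-- **`|∇_ν∇_μh_□(b)| ≤ c′²·C₂ˣ/(8S/5)²`**, any `ν, μ` (`S = M_h·L^{j(□)+1}`; p22 gen 26's unified second-difference step).
[cite: Balaban1984PropagatorsII, p.247 («|∇h_□′| ≤ O(1)(MLʲη)⁻¹», the second differences likewise — our reading), (2.92) p.239 line 1] -/
theorem abs_DV_DV_hB_le (hMh : 2 ≤ Mh) (hR : 2 * (ℓ + 1) ≤ R) (hP5 : ∀ μ, 5 ≤ P' μ) (cf : ℝ) (ν μ : Fin (d + 1)) (b : PBond (PV d ℓ m K hd hL) 0) :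
    |DV ν cf (DV μ cf (hB hN D c)) b| ≤ cf ^ 2 * (C2X d ℓ / (8 / 5 * (bigSide ℓ Mh c.1.1 : ℝ)) ^ 2) := by
  have h := abs_hT_diff_step_le (DT := D) (one_le_ell hL) hMh hR hP5 c ν μ (toBox hN b.src)
  have e : DV ν cf (DV μ cf (hB hN D c)) b = cf ^ 2 *
      (hT D c (tshift (N0 ℓ Mh k P') (unitVec μ) (tshift (N0 ℓ Mh k P') (unitVec ν) (toBox hN b.src))) -
        hT D c (tshift (N0 ℓ Mh k P') (unitVec ν) (toBox hN b.src)) - hT D c (tshift (N0 ℓ Mh k P') (unitVec μ) (toBox hN b.src)) +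
        hT D c (toBox hN b.src)) := by
    simp only [DV_apply, hB_apply, toBox_shift hN]; ring
  rw [e, abs_mul, abs_of_nonneg (sq_nonneg cf)]
  exact mul_le_mul_of_nonneg_left h (sq_nonneg cf)

/-- **`|∇_ν(S_μh_□)(b)| ≤ |c′|·C1F/(8S/5)`** (the first-step size at the torus neighbours `b + e_μ + e_ν`, `b + e_μ`).
[cite: Balaban1984PropagatorsII, p.247 («|∇h_□′| ≤ O(1)(MLʲη)⁻¹»), (2.92) p.239 line 1] -/
theorem abs_DV_shB_hB_le (hMh : 2 ≤ Mh) (hR : 2 * (ℓ + 1) ≤ R) (hP5 : ∀ μ, 5 ≤ P' μ) (cf : ℝ) (ν μ : Fin (d + 1)) (b : PBond (PV d ℓ m K hd hL) 0) :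
    |DV ν cf (shB μ (hB hN D c)) b| ≤ |cf| * (C1F d ℓ / (8 / 5 * (bigSide ℓ Mh c.1.1 : ℝ))) := by
  have h1 : ∀ i, 1 ≤ N0 ℓ Mh k P' i := one_le_of_mem (toBox hN b.src).2
  have e : DV ν cf (shB μ (hB hN D c)) b = cf * (hT D c (tshift (N0 ℓ Mh k P') (unitVec μ) (tshift (N0 ℓ Mh k P') (unitVec ν) (toBox hN b.src))) -
      hT D c (tshift (N0 ℓ Mh k P') (unitVec μ) (toBox hN b.src))) := by
    simp only [DV_apply, shB_apply, hB_apply, toBox_shift hN]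
  rw [e, abs_mul]
  refine mul_le_mul_of_nonneg_left (B6Partition118KLevelTorusBinders.abs_hT_sub_le_near (one_le_ell hL) hMh hR hP5 c ?_) (abs_nonneg _)
  rw [torusSupNorm_tshift_sub, show (toBox hN b.src).1 - (tshift (N0 ℓ Mh k P') (unitVec ν) (toBox hN b.src)).1 =
    -((tshift (N0 ℓ Mh k P') (unitVec ν) (toBox hN b.src)).1 - (toBox hN b.src).1) by abel, torusSupNorm_neg h1]
  exact torusSupNorm_tshift_unitVec_le h1 ν _

/-- **`|S_ν(∇_μh_□)(b)| ≤ |c′|·C1F/(8S/5)`**. [cite: Balaban1984PropagatorsII, p.247 («|∇h_□′| ≤ O(1)(MLʲη)⁻¹»), (2.92) p.239 line 1] -/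
theorem abs_shB_DV_hB_le (hMh : 2 ≤ Mh) (hR : 2 * (ℓ + 1) ≤ R) (hP5 : ∀ μ, 5 ≤ P' μ) (cf : ℝ) (ν μ : Fin (d + 1)) (b : PBond (PV d ℓ m K hd hL) 0) :
    |shB ν (DV μ cf (hB hN D c)) b| ≤ |cf| * (C1F d ℓ / (8 / 5 * (bigSide ℓ Mh c.1.1 : ℝ))) := by
  rw [shB_apply, B6GradLegKLevelV1.abs_DV_apply]
  exact mul_le_mul_of_nonneg_left (B6GradLegKLevelV1.abs_hB_shift_sub_le hN c hMh hR hP5 μ ⟨b.src.shift ν, b.dir⟩) (abs_nonneg _)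

/-- `supp ∇_ν∇_μh_□`: if `(∇_ν∇_μh_□)(b) ≠ 0` then the block of `b` lies in `□⁺`. [cite: Balaban1984PropagatorsII, p.239/p.247 (supports of h_□), bookkeeping] -/
theorem DV_DV_hB_support (hM8 : 8 ≤ Mh) (hR : 2 * (ℓ + 1) ≤ R) (hP5 : ∀ μ, 5 ≤ P' μ) (cf : ℝ) (ν μ : Fin (d + 1))
    {b : PBond (PV d ℓ m K hd hL) 0} (h : DV ν cf (DV μ cf (hB hN D c)) b ≠ 0) : blkV1 hN D b ∈ ST D hMh1 hP4 c := by
  have hMh : 2 ≤ Mh := le_trans (by norm_num) hM8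
  by_cases h2 : hB hN D c ⟨(b.src.shift ν).shift μ, b.dir⟩ ≠ 0
  · exact blkV1_mem_ST_of_hB_shift_shift_ne_zero hN hMh1 hP4 c hM8 hR hP5 ν μ h2
  by_cases hν : hB hN D c ⟨b.src.shift ν, b.dir⟩ ≠ 0
  · exact blkV1_mem_ST_of_hB_shift_ne_zero hN hMh1 hP4 c hM8 hR hP5 ν hν
  by_cases hμ : hB hN D c ⟨b.src.shift μ, b.dir⟩ ≠ 0
  · exact blkV1_mem_ST_of_hB_shift_ne_zero hN hMh1 hP4 c hM8 hR hP5 μ hμ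
  by_cases h0 : hB hN D c b ≠ 0
  · exact (mem_ST D hMh1 hP4 c _).2 (blkV1_mem_QT_of_hB_ne_zero hN D hMh hR hP4 c h0)
  exfalso; apply h
  have e : DV ν cf (DV μ cf (hB hN D c)) b = cf * (cf * (hB hN D c ⟨(b.src.shift ν).shift μ, b.dir⟩ - hB hN D c ⟨b.src.shift ν, b.dir⟩) -
      cf * (hB hN D c ⟨b.src.shift μ, b.dir⟩ - hB hN D c b)) := by
    simp only [DV_apply]
  rw [e, not_not.1 h2, not_not.1 hν, not_not.1 hμ, not_not.1 h0]; ring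

/-- `supp S_νS_μh_□`: if `h_□(b + e_ν + e_μ) ≠ 0` then the block of `b` lies in `□⁺` (restated for the multiplier `shB ν (shB μ h_□)`).
[cite: Balaban1984PropagatorsII, p.239/p.247 (supports of h_□), bookkeeping] -/
theorem shB_shB_hB_support (hM8 : 8 ≤ Mh) (hR : 2 * (ℓ + 1) ≤ R) (hP5 : ∀ μ, 5 ≤ P' μ) (ν μ : Fin (d + 1))
    {b : PBond (PV d ℓ m K hd hL) 0} (h : shB ν (shB μ (hB hN D c)) b ≠ 0) : blkV1 hN D b ∈ ST D hMh1 hP4 c := by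
  rw [shB_apply, shB_apply] at h
  exact blkV1_mem_ST_of_hB_shift_shift_ne_zero hN hMh1 hP4 c hM8 hR hP5 ν μ h

/-- `supp ∇_ν(S_μh_□) ⊂` blocks of `□⁺`. [cite: Balaban1984PropagatorsII, p.239/p.247 (supports of h_□), bookkeeping] -/
theorem DV_shB_hB_support (hM8 : 8 ≤ Mh) (hR : 2 * (ℓ + 1) ≤ R) (hP5 : ∀ μ, 5 ≤ P' μ) (cf : ℝ) (ν μ : Fin (d + 1))
    {b : PBond (PV d ℓ m K hd hL) 0} (h : DV ν cf (shB μ (hB hN D c)) b ≠ 0) : blkV1 hN D b ∈ ST D hMh1 hP4 c := by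
  by_cases h2 : hB hN D c ⟨(b.src.shift ν).shift μ, b.dir⟩ ≠ 0
  · exact blkV1_mem_ST_of_hB_shift_shift_ne_zero hN hMh1 hP4 c hM8 hR hP5 ν μ h2
  by_cases hμ : hB hN D c ⟨b.src.shift μ, b.dir⟩ ≠ 0
  · exact blkV1_mem_ST_of_hB_shift_ne_zero hN hMh1 hP4 c hM8 hR hP5 μ hμ
  exfalso; apply h
  have e : DV ν cf (shB μ (hB hN D c)) b = cf * (hB hN D c ⟨(b.src.shift ν).shift μ, b.dir⟩ - hB hN D c ⟨b.src.shift μ, b.dir⟩) := by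
    simp only [DV_apply, shB_apply]
  rw [e, not_not.1 h2, not_not.1 hμ]; ring

/-- `supp S_ν(∇_μh_□) ⊂` blocks of `□⁺`. [cite: Balaban1984PropagatorsII, p.239/p.247 (supports of h_□), bookkeeping] -/
theorem shB_DV_hB_support (hM8 : 8 ≤ Mh) (hR : 2 * (ℓ + 1) ≤ R) (hP5 : ∀ μ, 5 ≤ P' μ) (cf : ℝ) (ν μ : Fin (d + 1))
    {b : PBond (PV d ℓ m K hd hL) 0} (h : shB ν (DV μ cf (hB hN D c)) b ≠ 0) : blkV1 hN D b ∈ ST D hMh1 hP4 c := by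
  by_cases h2 : hB hN D c ⟨(b.src.shift ν).shift μ, b.dir⟩ ≠ 0
  · exact blkV1_mem_ST_of_hB_shift_shift_ne_zero hN hMh1 hP4 c hM8 hR hP5 ν μ h2
  by_cases hν : hB hN D c ⟨b.src.shift ν, b.dir⟩ ≠ 0
  · exact blkV1_mem_ST_of_hB_shift_ne_zero hN hMh1 hP4 c hM8 hR hP5 ν hν
  exfalso; apply h
  have e : shB ν (DV μ cf (hB hN D c)) b = cf * (hB hN D c ⟨(b.src.shift ν).shift μ, b.dir⟩ - hB hN D c ⟨b.src.shift ν, b.dir⟩) := by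
    simp only [DV_apply, shB_apply]
  rw [e, not_not.1 h2, not_not.1 hν]; ring

include hMha in
/-- the chart translate of `S_νS_μh_□` is supported on `1`-deep bonds of the member's window (r03's `hch_deep`: margin `4L^{j₀+1} ≥ 3`).
[cite: Balaban1984PropagatorsII, p.238 (□ ⊂ □̃³), (2.36) p.229, bookkeeping] -/
theorem shB_shB_hB_deep (hM8 : 8 ≤ Mh) (hR2 : 2 * (ℓ + 1) ^ 2 ≤ R) (hpl : Placed ℓ k P' c.1) (w : BondIdx (domT hN D hk) → ℝ) (cf : ℝ)
    (ν μ : Fin (d + 1)) (b : PBond (PV d ℓ m K hd hL) 0) (hb : trV (vch Mh k (svec ℓ k c.1.1 c.1.2)) (shB ν (shB μ (hB hN D c))) b ≠ 0) :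
    b.src ∈ DeepS (tC hN hk hMh1 hP4 c ha a (wC hN hk c w) cf) (x0 ℓ Mh k c.1) 1 := by
  rw [trV_shB, shB_apply, trV_shB, shB_apply, trV_hB hN hMh1 hP4 c] at hb
  have hdeep := hch_deep hN hMh1 hP4 hMha c ha hM8 hR2 hb
  have h3 : (⟨(b.src.shift ν).shift μ, b.dir⟩ : PBond (PV d ℓ m K hd hL) 0).src ∈
      DeepS (tC hN hk hMh1 hP4 c ha a (wC hN hk c w) cf) (x0 ℓ Mh k c.1) (1 + 1 + 1) := by
    refine deepS_mono ?_ hdeep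
    have : 1 ≤ (ℓ + 1) ^ (j0 hMh1 hP4 c + 1) := Nat.one_le_pow _ _ (Nat.succ_pos ℓ)
    omega
  have h2 := (unshift_mem_deepS (t := tC hN hk hMh1 hP4 c ha a (wC hN hk c w) cf) (hx0 hpl) h3 μ).1
  simp only [unshift_shift] at h2
  have h1 := (unshift_mem_deepS (t := tC hN hk hMh1 hP4 c ha a (wC hN hk c w) cf) (hx0 hpl) h2 ν).1
  simpa [unshift_shift] using h1

include hMha in
/-- the chart translate of `∇_ν(S_μh_□)` is supported on `1`-deep bonds. [cite: Balaban1984PropagatorsII, p.238 (□ ⊂ □̃³), bookkeeping] -/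
theorem DV_shB_hB_deep (hM8 : 8 ≤ Mh) (hR2 : 2 * (ℓ + 1) ^ 2 ≤ R) (hpl : Placed ℓ k P' c.1) (w : BondIdx (domT hN D hk) → ℝ) (cf cf' : ℝ)
    (ν μ : Fin (d + 1)) (b : PBond (PV d ℓ m K hd hL) 0) (hb : trV (vch Mh k (svec ℓ k c.1.1 c.1.2)) (DV ν cf' (shB μ (hB hN D c))) b ≠ 0) :
    b.src ∈ DeepS (tC hN hk hMh1 hP4 c ha a (wC hN hk c w) cf) (x0 ℓ Mh k c.1) 1 := by
  by_cases h1 : trV (vch Mh k (svec ℓ k c.1.1 c.1.2)) (shB ν (shB μ (hB hN D c))) b ≠ 0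
  · exact shB_shB_hB_deep hN hk hMh1 hP4 hMha c ha hM8 hR2 hpl w cf ν μ b h1
  · have h2 : trV (vch Mh k (svec ℓ k c.1.1 c.1.2)) (shB μ (hB hN D c)) b ≠ 0 := by
      intro h0; apply hb
      rw [trV_apply, DV_apply]
      rw [trV_apply, shB_apply] at h1
      rw [trV_apply] at h0
      rw [not_not.1 h1, h0]; ring
    exact shB_hB_deep hN hk hMh1 hP4 hMha c ha hM8 hR2 hpl w cf μ b h2

include hMha in
/-- the chart translate of `S_ν(∇_μh_□)` is supported on `1`-deep bonds. [cite: Balaban1984PropagatorsII, p.238 (□ ⊂ □̃³), bookkeeping] -/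
theorem shB_DV_hB_deep (hM8 : 8 ≤ Mh) (hR2 : 2 * (ℓ + 1) ^ 2 ≤ R) (hpl : Placed ℓ k P' c.1) (w : BondIdx (domT hN D hk) → ℝ) (cf cf' : ℝ)
    (ν μ : Fin (d + 1)) (b : PBond (PV d ℓ m K hd hL) 0) (hb : trV (vch Mh k (svec ℓ k c.1.1 c.1.2)) (shB ν (DV μ cf' (hB hN D c))) b ≠ 0) :
    b.src ∈ DeepS (tC hN hk hMh1 hP4 c ha a (wC hN hk c w) cf) (x0 ℓ Mh k c.1) 1 := by
  by_cases h1 : trV (vch Mh k (svec ℓ k c.1.1 c.1.2)) (shB ν (shB μ (hB hN D c))) b ≠ 0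
  · exact shB_shB_hB_deep hN hk hMh1 hP4 hMha c ha hM8 hR2 hpl w cf ν μ b h1
  · have h2 : trV (vch Mh k (svec ℓ k c.1.1 c.1.2)) (shB ν (hB hN D c)) b ≠ 0 := by
      intro h0; apply hb
      rw [trV_apply, shB_apply, DV_apply]
      rw [trV_apply, shB_apply, shB_apply] at h1
      rw [trV_apply, shB_apply] at h0
      rw [not_not.1 h1, h0]; ring
    exact shB_hB_deep hN hk hMh1 hP4 hMha c ha hM8 hR2 hpl w cf ν b h2

/-! ## §3  The operator identities: `E_(ν,+)E_(μ,+)G_□` as one transplant, and `∇_ν∇_μ(h_□G_□h_□)` expanded -/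

/-- **`E_(ν,+)E_(μ,+)G_□ = τ_{−v}(s(□)⁻¹•ε(∇_ν∇_μG_□)ρ)τ_v`**: the product of the three conjugated transplants through the BIJECTIVE window is the
transplant of the product (as r03's `EC_mul_Gl_eq`). [cite: Balaban1984PropagatorsII, (2.92) p.239 (line 1), (2.133) p.247, p.238 (T_□ = □̃³), dictionary (charts)] -/
theorem EC_mul_EC_mul_Gl_eq (hpl : Placed ℓ k P' c.1) (w : BondIdx (domT hN D hk) → ℝ) (cf : ℝ) (ν μ : Fin (d + 1)) :
    EC hN hk hMh1 hP4 hMha c ha hpl w cf (ν, true) * (EC hN hk hMh1 hP4 hMha c ha hpl w cf (μ, true) * Gl hN hk hMh1 hP4 hMha c ha hpl w cf) =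
      TB (-vch Mh k (svec ℓ k c.1.1 c.1.2)) *
      ((sc hMh1 hP4 c cf)⁻¹ • transplant (cB (tC hN hk hMh1 hP4 c ha a (wC hN hk c w) cf) (x0 ℓ Mh k c.1) (hx0 hpl) (hfit hN hMh1 hP4 hMha c ha hpl)).W
        (eB (tC hN hk hMh1 hP4 c ha a (wC hN hk c w) cf) (x0 ℓ Mh k c.1))
        (onFun ((tC hN hk hMh1 hP4 c ha a (wC hN hk c w) cf).Dl ν ∘ₗ (tC hN hk hMh1 hP4 c ha a (wC hN hk c w) cf).Dl μ ∘ₗ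
          (tC hN hk hMh1 hP4 c ha a (wC hN hk c w) cf).D.G))) *
      TB (vch Mh k (svec ℓ k c.1.1 c.1.2)) := by
  rw [EC_true, EC_true, Gl_eq, conj_mul, conj_mul, mul_smul_comm, mul_smul_comm, onFun_comp, onFun_comp, ← Module.End.mul_eq_comp,
    ← Module.End.mul_eq_comp,
    transplant_mul_of_bij (W := (cB (tC hN hk hMh1 hP4 c ha a (wC hN hk c w) cf) (x0 ℓ Mh k c.1) (hx0 hpl) (hfit hN hMh1 hP4 hMha c ha hpl)).W)
      (e := eB (tC hN hk hMh1 hP4 c ha a (wC hN hk c w) cf) (x0 ℓ Mh k c.1))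
      (cB (tC hN hk hMh1 hP4 c ha a (wC hN hk c w) cf) (x0 ℓ Mh k c.1) (hx0 hpl) (hfit hN hMh1 hP4 hMha c ha hpl)).inj
      (cB (tC hN hk hMh1 hP4 c ha a (wC hN hk c w) cf) (x0 ℓ Mh k c.1) (hx0 hpl) (hfit hN hMh1 hP4 hMha c ha hpl)).surj,
    transplant_mul_of_bij (W := (cB (tC hN hk hMh1 hP4 c ha a (wC hN hk c w) cf) (x0 ℓ Mh k c.1) (hx0 hpl) (hfit hN hMh1 hP4 hMha c ha hpl)).W)
      (e := eB (tC hN hk hMh1 hP4 c ha a (wC hN hk c w) cf) (x0 ℓ Mh k c.1))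
      (cB (tC hN hk hMh1 hP4 c ha a (wC hN hk c w) cf) (x0 ℓ Mh k c.1) (hx0 hpl) (hfit hN hMh1 hP4 hMha c ha hpl)).inj
      (cB (tC hN hk hMh1 hP4 c ha a (wC hN hk c w) cf) (x0 ℓ Mh k c.1) (hx0 hpl) (hfit hN hMh1 hP4 hMha c ha hpl)).surj]

include hMha in
/-- **THE OPERATOR IDENTITY FOR THE FIRST LEG OF `∇_ν∇_μG`**:
`∇_ν∇_μ(h_□G_□h_□) = (c′/L^{j₀})²•((S_νS_μh_□)·(E_(ν,+)E_(μ,+)G_□)·h_□) + (c′/L^{j₀})•((∇_ν(S_μh_□))·(E_(μ,+)G_□)·h_□)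
+ (c′/L^{j₀})•((S_ν(∇_μh_□))·(E_(ν,+)G_□)·h_□) + (∇_ν∇_μh_□)·G_□·h_□` on the global torus (p38's `DV_sandwich_eq`, then the product rule once more).
[cite: Balaban1984PropagatorsII, (2.141) p.247 (first leg), (2.92) p.239 (line 1), (2.94) p.239] -/
theorem DV_DV_sandwich_eq (hM8 : 8 ≤ Mh) (hR2 : 2 * (ℓ + 1) ^ 2 ≤ R) (hpl : Placed ℓ k P' c.1) (w : BondIdx (domT hN D hk) → ℝ) {cf : ℝ}
    (hcf : cf ≠ 0) (ν μ : Fin (d + 1)) :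
    DV ν cf * (DV μ cf * (mulOp (hB hN D c) * Gl hN hk hMh1 hP4 hMha c ha hpl w cf * mulOp (hB hN D c))) =
      (cf / (((ℓ + 1 : ℕ) : ℝ)) ^ j0 hMh1 hP4 c) ^ 2 •
          (mulOp (shB ν (shB μ (hB hN D c))) *
            (EC hN hk hMh1 hP4 hMha c ha hpl w cf (ν, true) * (EC hN hk hMh1 hP4 hMha c ha hpl w cf (μ, true) * Gl hN hk hMh1 hP4 hMha c ha hpl w cf)) *
            mulOp (hB hN D c)) +
        (cf / (((ℓ + 1 : ℕ) : ℝ)) ^ j0 hMh1 hP4 c) •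
          (mulOp (DV ν cf (shB μ (hB hN D c))) * (EC hN hk hMh1 hP4 hMha c ha hpl w cf (μ, true) * Gl hN hk hMh1 hP4 hMha c ha hpl w cf) *
            mulOp (hB hN D c)) +
        (cf / (((ℓ + 1 : ℕ) : ℝ)) ^ j0 hMh1 hP4 c) •
          (mulOp (shB ν (DV μ cf (hB hN D c))) * (EC hN hk hMh1 hP4 hMha c ha hpl w cf (ν, true) * Gl hN hk hMh1 hP4 hMha c ha hpl w cf) *
            mulOp (hB hN D c)) +
        mulOp (DV ν cf (DV μ cf (hB hN D c))) * Gl hN hk hMh1 hP4 hMha c ha hpl w cf * mulOp (hB hN D c) := by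
  have hLj : ((((ℓ + 1 : ℕ) : ℝ)) ^ j0 hMh1 hP4 c) ≠ 0 := by positivity
  -- the two identifications `χ·DV_ν = (c′/L^{j₀})•χ·E_(ν,+)` on the deep supports
  have hh1 := shB_shB_hB_deep hN hk hMh1 hP4 hMha c ha hM8 hR2 hpl w cf ν μ
  have key1 := mulOp_mul_EC_true hN hk hMh1 hP4 hMha c ha hpl w hcf ν (shB ν (shB μ (hB hN D c))) ?key1
  case key1 => intro b hb; exact hh1 b hb
  have hh2 := shB_DV_hB_deep hN hk hMh1 hP4 hMha c ha hM8 hR2 hpl w cf cf ν μ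
  have key2 := mulOp_mul_EC_true hN hk hMh1 hP4 hMha c ha hpl w hcf ν (shB ν (DV μ cf (hB hN D c))) ?key2
  case key2 => intro b hb; exact hh2 b hb
  clear hh1 hh2
  have h1 := DV_sandwich_eq hN hk hMh1 hP4 hMha c ha hM8 hR2 hpl w hcf μ
  have hprod1 := DV_mul_mulOp ν cf (shB μ (hB hN D c))
  have hprod2 := DV_mul_mulOp ν cf (DV μ cf (hB hN D c))
  rw [h1]
  -- atoms
  generalize EC hN hk hMh1 hP4 hMha c ha hpl w cf (ν, true) = Eν at key1 key2 ⊢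
  generalize EC hN hk hMh1 hP4 hMha c ha hpl w cf (μ, true) = Eμ
  generalize Gl hN hk hMh1 hP4 hMha c ha hpl w cf = G
  generalize mulOp (shB ν (shB μ (hB hN D c))) = S2 at key1 hprod1 ⊢
  generalize mulOp (DV ν cf (shB μ (hB hN D c))) = DS at hprod1 ⊢
  generalize mulOp (shB ν (DV μ cf (hB hN D c))) = SD at key2 hprod2 ⊢
  generalize mulOp (DV ν cf (DV μ cf (hB hN D c))) = DD at hprod2 ⊢
  generalize mulOp (shB μ (hB hN D c)) = Sμ at hprod1 ⊢
  generalize mulOp (DV μ cf (hB hN D c)) = Dμ at hprod2 ⊢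
  generalize mulOp (hB hN D c) = Hm
  generalize (DV (P := PV d ℓ m K hd hL) ν cf) = Dv at key1 key2 hprod1 hprod2 ⊢
  have key1' : S2 * Dv = (cf / (((ℓ + 1 : ℕ) : ℝ)) ^ j0 hMh1 hP4 c) • (S2 * Eν) := by
    rw [key1, smul_smul, div_mul_div_comm, mul_comm cf, div_self (mul_ne_zero hLj hcf), one_smul]
  have key2' : SD * Dv = (cf / (((ℓ + 1 : ℕ) : ℝ)) ^ j0 hMh1 hP4 c) • (SD * Eν) := by
    rw [key2, smul_smul, div_mul_div_comm, mul_comm cf, div_self (mul_ne_zero hLj hcf), one_smul]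
  -- the two summands of p38's first-order identity, differentiated once more
  have e1 : Dv * (Sμ * (Eμ * G) * Hm) =
      (cf / (((ℓ + 1 : ℕ) : ℝ)) ^ j0 hMh1 hP4 c) • (S2 * (Eν * (Eμ * G)) * Hm) + DS * (Eμ * G) * Hm := by
    calc Dv * (Sμ * (Eμ * G) * Hm) = (Dv * Sμ) * (Eμ * G) * Hm := by simp only [mul_assoc]
      _ = (S2 * Dv + DS) * (Eμ * G) * Hm := by rw [hprod1]
      _ = _ := by rw [add_mul, add_mul, key1', smul_mul_assoc, smul_mul_assoc]; simp only [mul_assoc]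
  have e2 : Dv * (Dμ * G * Hm) = (cf / (((ℓ + 1 : ℕ) : ℝ)) ^ j0 hMh1 hP4 c) • (SD * (Eν * G) * Hm) + DD * G * Hm := by
    calc Dv * (Dμ * G * Hm) = (Dv * Dμ) * G * Hm := by simp only [mul_assoc]
      _ = (SD * Dv + DD) * G * Hm := by rw [hprod2]
      _ = _ := by rw [add_mul, add_mul, key2', smul_mul_assoc, smul_mul_assoc]; simp only [mul_assoc]
  rw [mul_add, mul_smul_comm, e1, e2, smul_add, smul_smul, ← sq]
  abel

end Cube

end Literature.MathematicalPhysics.QuantumFieldTheory.Balaban1983to89.B6RandomWalkL2Grad2CubeV1
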